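import Mathlib
import Summits.Ventures.PercRepro2.Defs
import Summits.Ventures.PercRepro2.Independence
import Summits.Ventures.PercRepro2.Harris
import Summits.Ventures.PercRepro2.Graph
import Summits.Ventures.PercRepro2.Exploration
import Summits.Ventures.PercRepro2.Events
import Summits.Ventures.PercRepro2.Induced
import Summits.Ventures.PercRepro2.SeedSet

/-!
# Exploration trees: edge-by-edge revelation, leaves, and the pinned (conditional) measure
(blind cell PercRepro2, typer-1; p1 g5 ask 2026-08-23T03:30:16Z — the path-exploration / leaf
vocabulary for `ZhTwoCopy_of_SL1`)

An **exploration** reveals edges one at a time, the next edge depending on what was seen: a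
decision tree `ETree E` (`leaf`, or `node e t₀ t₁` — reveal `e`, continue with `t₀` if closed, `t₁`
if open).  A **partial configuration** `Partial E` is the explored edge set `F` with the observed
states `σ`; its event is the cylinder `{ω = σ on F}` (`Partial.event`).  The **leaves** of a tree
started at `P` (`leaves t P`) are the partial configurations at the end of every branch; when every
edge is revealed at most once along each branch (`Valid t P.F`) their cylinders partition `P.event`:

* **`prob_leaves_sum`**: `Σ_{ℰ ∈ leaves t P} P(ℰ ∩ A) = P(P.event ∩ A)` for every event `A`
  (at `P = ∅`: `Σ_ℰ P(ℰ ∩ A) = P(A)`, `prob_leaves_sum_root`).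

Conditioning on a leaf is **pinning**: `pin p ℰ` puts weight `1` on the explored open edges and `0`
on the explored closed ones and leaves the unexplored weights alone (`IsProbVec` is preserved,
`isProbVec_pin`); the product measure `prob (pin p ℰ)` is the conditional law given `ℰ` — the
unexplored edges stay an independent product measure (the spatial Markov property at a stopping
set).  Exactly (no division):

* **`prob_event_inter`**: `P(ℰ ∩ A) = P(ℰ) · P_{pin p ℰ}(A)`;
* **`expect_mul_indicator_event`**: `E[f · 1_ℰ] = P(ℰ) · E_{pin p ℰ}[f]`;
* `weight_pin_eq`: the pinned weight is `1_ℰ(ω) · ∏_{e ∉ F} edgeFactor (p e) (ω e)`.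

Reading the per-leaf quantities of `P1-L1TWOCOPY.md` §6: `P(X ∣ ℰ) = prob (pin p ℰ) X`,
`E[f ∣ ℰ] = expect (pin p ℰ) f`, and the leaf decomposition `P(T ∩ X) = Σ_{T-leaves} P(ℰ) P(X ∣ ℰ)` is
`prob_leaves_sum` + `prob_event_inter` once the T-leaves are singled out (the exploration from `a₃`
and its invariants are the next file).  `ClusterDetermined ℰ a₂ S` ("on `ℰ` the cluster of `a₂` is
the union cluster of the explored seed set `S`") is the hypothesis under which the multi-source
BHK inequality `bhk_multi` applies in the residual graph of a leaf
(`expect_pin_cluster_eq_clusterSet`).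
-/

namespace Summit.Ventures.PercRepro2

namespace ExplorationTree

/-! ## Trees, partial configurations, leaves -/

section Trees

/-- A decision tree over the edge set: at `node e t₀ t₁` the edge `e` is revealed; the exploration
continues with `t₀` if `e` is closed and with `t₁` if it is open. -/
inductive ETree (E : Type*) : Type _
  | leaf : ETree E
  | node (e : E) (t₀ t₁ : ETree E) : ETree E

/-- A partial configuration: the explored edges `F` and their observed states `σ` (the values of
`σ` off `F` are irrelevant). -/
structure Partial (E : Type*) where
  /-- the explored edges -/
  F : Finset E
  /-- the observed states -/
  σ : Config E

variable {E : Type*}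

/-- The cylinder event `{ω = σ on F}` of a partial configuration. -/
def Partial.event (P : Partial E) : Set (Config E) := cylinder P.F P.σ

/-- The partial configuration extended by the state `b` of the edge `e`. -/
def Partial.extend [DecidableEq E] (P : Partial E) (e : E) (b : Bool) : Partial E :=
  ⟨insert e P.F, Function.update P.σ e b⟩

/-- The leaves reached from the partial configuration `P` by the tree `t`: the explored
configurations at the end of every branch. -/
def leaves [DecidableEq E] : ETree E → Partial E → List (Partial E)
  | .leaf, P => [P]
  | .node e t₀ t₁, P => leaves t₀ (P.extend e false) ++ leaves t₁ (P.extend e true)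

/-- `Valid t F`: started from the explored set `F`, the tree `t` reveals every edge at most once
along each branch. -/
def Valid [DecidableEq E] : ETree E → Finset E → Prop
  | .leaf, _ => True
  | .node e t₀ t₁, F => e ∉ F ∧ Valid t₀ (insert e F) ∧ Valid t₁ (insert e F)

/-- The root partial configuration: nothing explored. -/
def root : Partial E := ⟨∅, fun _ => false⟩

/-- Membership in the event of a partial configuration. -/
@[simp] lemma Partial.mem_event {P : Partial E} {ω : Config E} :
    ω ∈ P.event ↔ ∀ e ∈ P.F, ω e = P.σ e := Iff.rfl

/-- The event of the root is everything. -/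
lemma root_event : (root : Partial E).event = Set.univ := by
  ext ω
  simp [Partial.event, cylinder, root]

/-- Updating `σ` off the explored set does not change the cylinder. -/
lemma cylinder_update_of_notMem [DecidableEq E] {F : Finset E} (σ : Config E) {e : E}
    (he : e ∉ F) (b : Bool) : cylinder F (Function.update σ e b) = cylinder F σ := by
  ext ω
  simp only [mem_cylinder]
  constructor
  · intro h e' he'
    have := h e' he'
    rwa [Function.update_of_ne (fun h' : e' = e => he (h' ▸ he'))] at this
  · intro h e' he'
    rw [Function.update_of_ne (fun h' : e' = e => he (h' ▸ he'))]
    exact h e' he'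

/-- The event of the extension by a closed edge (`e` not yet explored). -/
lemma extend_event_false [DecidableEq E] (P : Partial E) {e : E} (he : e ∉ P.F) :
    (P.extend e false).event = P.event ∩ closedEdge e := by
  unfold Partial.extend Partial.event
  simp only
  rw [cylinder_insert, cylinder_update_of_notMem P.σ he, Function.update_self]
  simp

/-- The event of the extension by an open edge (`e` not yet explored). -/
lemma extend_event_true [DecidableEq E] (P : Partial E) {e : E} (he : e ∉ P.F) :
    (P.extend e true).event = P.event ∩ openEdge e := by
  unfold Partial.extend Partial.event
  simp only
  rw [cylinder_insert, cylinder_update_of_notMem P.σ he, Function.update_self]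
  simp

end Trees

/-! ## The leaf partition -/

section Partition

variable {E : Type*} [Fintype E] [DecidableEq E] {R : Type*} [CommRing R]

/-- **The leaves of a valid tree partition the event of its root**: for every event `A`,
`Σ_{ℰ ∈ leaves t P} P(ℰ ∩ A) = P(P.event ∩ A)`. -/
theorem prob_leaves_sum (p : E → R) (t : ETree E) :
    ∀ (P : Partial E), Valid t P.F → ∀ A : Set (Config E),
      ((leaves t P).map fun ℓ => prob p (ℓ.event ∩ A)).sum = prob p (P.event ∩ A) := by
  induction t with
  | leaf =>
    intro P _ A
    simp [leaves]
  | node e t₀ t₁ ih₀ ih₁ =>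
    intro P hv A
    obtain ⟨he, hv₀, hv₁⟩ := hv
    simp only [leaves, List.map_append, List.sum_append]
    rw [ih₀ (P.extend e false) hv₀ A, ih₁ (P.extend e true) hv₁ A,
      extend_event_false P he, extend_event_true P he]
    have h := prob_inter_add_prob_inter_compl p (P.event ∩ A) (openEdge e)
    rw [← closedEdge_eq_compl] at h
    have e1 : P.event ∩ closedEdge e ∩ A = P.event ∩ A ∩ closedEdge e := by
      ext ω; simp only [Set.mem_inter_iff]; tauto
    have e2 : P.event ∩ openEdge e ∩ A = P.event ∩ A ∩ openEdge e := by
      ext ω; simp only [Set.mem_inter_iff]; tauto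
    rw [e1, e2]
    linear_combination h

/-- The leaf partition from the root: `Σ_{ℰ ∈ leaves t root} P(ℰ ∩ A) = P(A)`. -/
theorem prob_leaves_sum_root (p : E → R) (t : ETree E) (hv : Valid t ∅) (A : Set (Config E)) :
    ((leaves t root).map fun ℓ => prob p (ℓ.event ∩ A)).sum = prob p A := by
  rw [prob_leaves_sum p t root hv A, root_event, Set.univ_inter]

end Partition

/-! ## The pinned measure: conditioning on a partial configuration -/

section Pin

variable {E : Type*} [Fintype E] [DecidableEq E] {R : Type*} [CommRing R]

/-- The weights pinned on the explored edges of `P`: `1` on the explored open edges, `0` on the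
explored closed ones, `p e` elsewhere.  `prob (pin p P)` is the conditional law given `P.event`. -/
def pin (p : E → R) (P : Partial E) : E → R :=
  fun e => if e ∈ P.F then (if P.σ e then 1 else 0) else p e

omit [Fintype E] in
/-- `pin` on an explored edge. -/
lemma pin_of_mem (p : E → R) (P : Partial E) {e : E} (he : e ∈ P.F) :
    pin p P e = if P.σ e then 1 else 0 := by
  simp [pin, he]

omit [Fintype E] in
/-- `pin` on an unexplored edge. -/
lemma pin_of_notMem (p : E → R) (P : Partial E) {e : E} (he : e ∉ P.F) : pin p P e = p e := by
  simp [pin, he]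

/-- The Bernoulli factor of a pinned edge is the indicator of "the observed state". -/
lemma edgeFactor_pin (b b' : Bool) :
    edgeFactor (if b then (1 : R) else 0) b' = if b' = b then 1 else 0 := by
  cases b <;> cases b' <;> simp [edgeFactor]

/-- **The pinned weight** is `1_{P.event}(ω) · ∏_{e ∉ F} edgeFactor (p e) (ω e)`. -/
theorem weight_pin_eq (p : E → R) (P : Partial E) (ω : Config E) :
    weight (pin p P) ω =
      P.event.indicator 1 ω * ∏ e ∈ P.Fᶜ, edgeFactor (p e) (ω e) := by
  unfold weight
  rw [← Finset.prod_mul_prod_compl P.F]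
  congr 1
  · rw [Finset.prod_congr rfl fun e he => by rw [pin_of_mem p P he, edgeFactor_pin]]
    rw [Finset.prod_boole]
    by_cases h : ω ∈ P.event
    · rw [Set.indicator_of_mem h, if_pos (fun e he => h e he)]
      rfl
    · rw [Set.indicator_of_notMem h, if_neg (fun h' => h fun e he => h' e he)]
  · exact Finset.prod_congr rfl fun e he => by
      rw [pin_of_notMem p P (Finset.mem_compl.1 he)]

/-- On `P.event` the weight factorises as `P(P.event) · ∏_{e ∉ F} edgeFactor (p e) (ω e)`. -/
theorem weight_eq_of_mem_event (p : E → R) (P : Partial E) {ω : Config E} (hω : ω ∈ P.event) :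
    weight p ω = prob p P.event * ∏ e ∈ P.Fᶜ, edgeFactor (p e) (ω e) := by
  unfold weight
  rw [← Finset.prod_mul_prod_compl P.F]
  congr 1
  unfold Partial.event
  rw [prob_cylinder]
  exact Finset.prod_congr rfl fun e he => by rw [hω e he]

/-- **Conditioning is pinning**: `weight p ω · 1_{P.event}(ω) = P(P.event) · weight (pin p P) ω`. -/
theorem weight_mul_indicator_event (p : E → R) (P : Partial E) (ω : Config E) :
    weight p ω * P.event.indicator 1 ω = prob p P.event * weight (pin p P) ω := by
  rw [weight_pin_eq]
  by_cases hω : ω ∈ P.event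
  · rw [Set.indicator_of_mem hω, weight_eq_of_mem_event p P hω]
    simp only [Pi.one_apply, mul_one, one_mul]
  · rw [Set.indicator_of_notMem hω]
    simp

/-- **`E[f · 1_ℰ] = P(ℰ) · E_{pin p ℰ}[f]`**. -/
theorem expect_mul_indicator_event (p : E → R) (P : Partial E) (f : Config E → R) :
    expect p (fun ω => f ω * P.event.indicator 1 ω) = prob p P.event * expect (pin p P) f := by
  unfold expect
  rw [Finset.mul_sum]
  refine Finset.sum_congr rfl fun ω _ => ?_
  have h := weight_mul_indicator_event p P ω
  calc weight p ω * (f ω * P.event.indicator 1 ω)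
      = (weight p ω * P.event.indicator 1 ω) * f ω := by ring
    _ = (prob p P.event * weight (pin p P) ω) * f ω := by rw [h]
    _ = prob p P.event * (weight (pin p P) ω * f ω) := by ring

/-- **`P(ℰ ∩ A) = P(ℰ) · P_{pin p ℰ}(A)`**: the conditional law given a partial configuration is the
pinned product measure. -/
theorem prob_event_inter (p : E → R) (P : Partial E) (A : Set (Config E)) :
    prob p (P.event ∩ A) = prob p P.event * prob (pin p P) A := by
  rw [prob_eq_expect_indicator p (P.event ∩ A), prob_eq_expect_indicator (pin p P) A]
  have e : (P.event ∩ A).indicator (1 : Config E → R) =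
      fun ω => A.indicator 1 ω * P.event.indicator 1 ω := by
    funext ω
    rw [indicator_inter_one, mul_comm]
  rw [e]
  exact expect_mul_indicator_event p P (A.indicator 1)

/-- The pinned weight vanishes off `P.event`. -/
lemma weight_pin_eq_zero_of_notMem (p : E → R) (P : Partial E) {ω : Config E}
    (hω : ω ∉ P.event) : weight (pin p P) ω = 0 := by
  rw [weight_pin_eq, Set.indicator_of_notMem hω, zero_mul]

/-- Expectations under the pinned measure only see `P.event`: `E_{pin}[f] = E_{pin}[g]` when
`f = g` on `P.event`. -/
theorem expect_pin_congr (p : E → R) (P : Partial E) {f g : Config E → R}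
    (h : ∀ ω ∈ P.event, f ω = g ω) : expect (pin p P) f = expect (pin p P) g := by
  unfold expect
  refine Finset.sum_congr rfl fun ω _ => ?_
  by_cases hω : ω ∈ P.event
  · rw [h ω hω]
  · rw [weight_pin_eq_zero_of_notMem p P hω, zero_mul, zero_mul]

end Pin

section PinProb

variable {E : Type*} [Fintype E] [DecidableEq E] {R : Type*} [CommRing R] [LinearOrder R]
  [IsOrderedRing R]

omit [Fintype E] in
/-- Pinning keeps the weights admissible. -/
lemma isProbVec_pin {p : E → R} (hp : IsProbVec p) (P : Partial E) : IsProbVec (pin p P) := by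
  refine ⟨fun e => ?_, fun e => ?_⟩
  · by_cases he : e ∈ P.F
    · rw [pin_of_mem p P he]
      split_ifs <;> norm_num
    · rw [pin_of_notMem p P he]
      exact hp.nonneg e
  · by_cases he : e ∈ P.F
    · rw [pin_of_mem p P he]
      split_ifs <;> norm_num
    · rw [pin_of_notMem p P he]
      exact hp.le_one e

end PinProb

/-! ## Clusters determined by an explored seed set -/

section Seed

variable {V : Type*} {E : Type*}

/-- `ClusterDetermined ends P x S`: on the partial configuration `P`, the cluster of `x` is the
union cluster of the explored seed set `S` (the invariant of an exploration that has revealed an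
open connected set `S ∋ x` — the residual growth only uses unexplored edges). -/
def ClusterDetermined (ends : E → Sym2 V) (P : Partial E) (x : V) (S : Finset V) : Prop :=
  ∀ ω ∈ P.event, cluster ends ω x = clusterSet ends ω S

variable [Fintype E] [DecidableEq E] {R : Type*} [CommRing R]

/-- Under the pinned measure of a leaf with `ClusterDetermined`, any observable of `C(x)` is the
same observable of the union cluster of the seed set — the form in which the multi-source BHK
inequality `bhk_multi` applies in the residual graph of the leaf. -/
theorem expect_pin_cluster_eq_clusterSet (p : E → R) (ends : E → Sym2 V) (P : Partial E) {x : V}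
    {S : Finset V} (h : ClusterDetermined ends P x S) (G : Set V → Config E → R) :
    expect (pin p P) (fun ω => G (cluster ends ω x) ω) =
      expect (pin p P) (fun ω => G (clusterSet ends ω S) ω) :=
  expect_pin_congr p P fun ω hω => by rw [h ω hω]

end Seed

end ExplorationTree

end Summit.Ventures.PercRepro2
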